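import Mathlib
import HarnessLib
import Summits.HubbardSuperconductivity.HubbardSuperconductivity.Theorems.KLProgrammePerturbedFermiCurveHigherDerivs
import Summits.HubbardSuperconductivity.HubbardSuperconductivity.Theorems.KLProgrammeKLRegimeSplitTwoLegF

/-!
# Polar curves in `EuclideanSpace`: the EXACT graded jets `‖γ^{(i)}‖ = √(radial² + tangential²)` («(C1)-DEEP supplier», optional item (2))

Cell `gate-hubbard-kl`, seat hubbard-kl-k3c3-p3 (g11; row «implicit-function / monotonicity route»), `--supports stmt-HubbardSuperconductivity-20437`;
pen (R79).  `…PerturbedFermiCurveGradedPerOrder` bounds the curve jets of `γ = toLp ∘ (u•dir)` by `2·Σ C(i,k)U_k` (sup-norm Leibniz and `‖toLp‖ ≤ 2`);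
for the far rows of the deep (C1) door the fourth power of `D₁` matters (memo C1-JETBOX-DEEP §6(i): `8.8⁴` vs `3.23⁴` decides whether reading scale 6
is analytic).  This file gives the EXACT moving-frame forms (k3c3-p3 g2 `hasDerivAt_polar_zero…three`) and their Euclidean norms:

* §1 `norm_toLp_frame_comb`: `‖toLp 2 (a•dir θ + b•dir(θ+π/2))‖ = √(a² + b²)` (orthonormal moving frame);
* §2 `iteratedDeriv_polarLp_one…four`: `γ′ = u′e_r + u e_θ`, `γ″ = (u″−u)e_r + 2u′e_θ`, `γ‴ = (u‴−3u′)e_r + (3u″−u)e_θ`, `γ⁗ = (u⁗−6u″+u)e_r + 4(u‴−u′)e_θ`;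
* §3 **`polarLp_exact_graded_jets`**: from `|u| ≤ U₀`, `|u^{(j)}| ≤ R_j`: `‖γ′‖ ≤ √(R₁²+U₀²)`, `‖γ″‖ ≤ √((R₂+U₀)²+4R₁²)`, `‖γ‴‖ ≤ √((R₃+3R₁)²+(3R₂+U₀)²)`,
  `‖γ⁗‖ ≤ √((R₄+6R₂+U₀)²+16(R₃+R₁)²)`, packaged as the `hD` of `flowPiece_reading_remainder_jets_oneCall_structured`; §4 the frame instance
  (`klFermiPoint μ K = u_K • dir`, `rfl`).

On the KL window (`u ≤ 2.83`, `|u′| ≤ 1.55`, certified): `D₁ = 3.23` instead of `8.8`.  Proved; no definitions; nothing about the Hubbard model.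
-/

noncomputable section

namespace Summit.HubbardSuperconductivity.HubbardSuperconductivity.Theorems.PerturbedFermiCurve

set_option linter.dupNamespace false -- summit = problem name (single-conjunct summit), D-0017

open Real Set
open Literature.MathematicalPhysics.QuantumLattice Literature.MathematicalPhysics.QuantumLattice.BandSectorCounting

/-! ## §1 The orthonormal moving frame in `EuclideanSpace` -/

/-- `‖toLp 2 (a•dir θ + b•dir(θ + π/2))‖ = √(a² + b²)`. -/
theorem norm_toLp_frame_comb (a b θ : ℝ) :
    ‖(WithLp.toLp 2 (a • dir θ + b • dir (θ + π / 2)) : EuclideanSpace ℝ (Fin 2))‖ = Real.sqrt (a ^ 2 + b ^ 2) := by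
  rw [EuclideanSpace.norm_eq, Fin.sum_univ_two]
  congr 1
  simp only [Pi.add_apply, Pi.smul_apply, smul_eq_mul, dir_zero, dir_one, Real.norm_eq_abs, sq_abs,
    Real.cos_add_pi_div_two, Real.sin_add_pi_div_two]
  nlinarith [Real.sin_sq_add_cos_sq θ]

/-- From `|a| ≤ α`, `|b| ≤ β`: `√(a² + b²) ≤ √(α² + β²)`. -/
theorem sqrt_sq_add_sq_le_of_abs_le {a b α β : ℝ} (ha : |a| ≤ α) (hb : |b| ≤ β) : Real.sqrt (a ^ 2 + b ^ 2) ≤ Real.sqrt (α ^ 2 + β ^ 2) := by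
  apply Real.sqrt_le_sqrt
  have h1 : a ^ 2 ≤ α ^ 2 := by rw [← sq_abs a]; exact pow_le_pow_left₀ (abs_nonneg a) ha 2
  have h2 : b ^ 2 ≤ β ^ 2 := by rw [← sq_abs b]; exact pow_le_pow_left₀ (abs_nonneg b) hb 2
  linarith

/-! ## §2 The exact jets of `γ = toLp ∘ (u • dir)` -/

section Polar

variable {u : ℝ → ℝ} (hu : ContDiff ℝ 4 u)
include hu

/-- The four derivatives of `t ↦ toLp 2 (u t • dir t)` as moving-frame combinations (function-level identities). -/
theorem iteratedDeriv_polarLp_eqs :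
    (iteratedDeriv 1 (fun t : ℝ => (WithLp.toLp 2 (u t • dir t) : EuclideanSpace ℝ (Fin 2))) =
        fun t => WithLp.toLp 2 (deriv u t • dir t + u t • dir (t + π / 2))) ∧
    (iteratedDeriv 2 (fun t : ℝ => (WithLp.toLp 2 (u t • dir t) : EuclideanSpace ℝ (Fin 2))) =
        fun t => WithLp.toLp 2 ((deriv (deriv u) t - u t) • dir t + (2 * deriv u t) • dir (t + π / 2))) ∧
    (iteratedDeriv 3 (fun t : ℝ => (WithLp.toLp 2 (u t • dir t) : EuclideanSpace ℝ (Fin 2))) =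
        fun t => WithLp.toLp 2 ((deriv (deriv (deriv u)) t - 3 * deriv u t) • dir t + (3 * deriv (deriv u) t - u t) • dir (t + π / 2))) ∧
    (iteratedDeriv 4 (fun t : ℝ => (WithLp.toLp 2 (u t • dir t) : EuclideanSpace ℝ (Fin 2))) =
        fun t => WithLp.toLp 2 ((deriv (deriv (deriv (deriv u))) t - 6 * deriv (deriv u) t + u t) • dir t +
          (4 * deriv (deriv (deriv u)) t - 4 * deriv u t) • dir (t + π / 2))) := by
  set T := ((EuclideanSpace.equiv (Fin 2) ℝ).symm : (Fin 2 → ℝ) →L[ℝ] EuclideanSpace ℝ (Fin 2)) with hT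
  have hTapp : ∀ x : Fin 2 → ℝ, T x = WithLp.toLp 2 x := fun x => by simp [hT]
  -- each step: `(T ∘ f)′ = T ∘ f′`
  have step : ∀ {f : ℝ → (Fin 2 → ℝ)} {f' : ℝ → (Fin 2 → ℝ)}, (∀ t, HasDerivAt f (f' t) t) →
      deriv (fun t => (WithLp.toLp 2 (f t) : EuclideanSpace ℝ (Fin 2))) = fun t => WithLp.toLp 2 (f' t) := by
    intro f f' hf
    funext t
    have h := (T.hasFDerivAt.comp_hasDerivAt t (hf t))
    have h' : HasDerivAt (fun t => (WithLp.toLp 2 (f t) : EuclideanSpace ℝ (Fin 2))) (WithLp.toLp 2 (f' t)) t := by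
      have e1 : (⇑T ∘ f) = fun t => (WithLp.toLp 2 (f t) : EuclideanSpace ℝ (Fin 2)) := by funext s; simp [hTapp]
      rw [← e1, ← hTapp]; exact h
    exact h'.deriv
  have d1 := step (fun t => hasDerivAt_polar_zero hu t)
  have d2 := step (fun t => hasDerivAt_polar_one hu t)
  have d3 := step (fun t => hasDerivAt_polar_two hu t)
  have d4 := step (fun t => hasDerivAt_polar_three hu t)
  have e1 : iteratedDeriv 1 (fun t : ℝ => (WithLp.toLp 2 (u t • dir t) : EuclideanSpace ℝ (Fin 2))) =
      fun t => WithLp.toLp 2 (deriv u t • dir t + u t • dir (t + π / 2)) := by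
    rw [iteratedDeriv_one]; exact d1
  have e2 : iteratedDeriv 2 (fun t : ℝ => (WithLp.toLp 2 (u t • dir t) : EuclideanSpace ℝ (Fin 2))) =
      fun t => WithLp.toLp 2 ((deriv (deriv u) t - u t) • dir t + (2 * deriv u t) • dir (t + π / 2)) := by
    rw [iteratedDeriv_succ, e1]; exact d2
  have e3 : iteratedDeriv 3 (fun t : ℝ => (WithLp.toLp 2 (u t • dir t) : EuclideanSpace ℝ (Fin 2))) =
      fun t => WithLp.toLp 2 ((deriv (deriv (deriv u)) t - 3 * deriv u t) • dir t + (3 * deriv (deriv u) t - u t) • dir (t + π / 2)) := by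
    rw [iteratedDeriv_succ, e2]; exact d3
  have e4 : iteratedDeriv 4 (fun t : ℝ => (WithLp.toLp 2 (u t • dir t) : EuclideanSpace ℝ (Fin 2))) =
      fun t => WithLp.toLp 2 ((deriv (deriv (deriv (deriv u))) t - 6 * deriv (deriv u) t + u t) • dir t +
        (4 * deriv (deriv (deriv u)) t - 4 * deriv u t) • dir (t + π / 2)) := by
    rw [iteratedDeriv_succ, e3]; exact d4
  exact ⟨e1, e2, e3, e4⟩

/-- **THE EXACT GRADED JETS OF A POLAR CURVE IN `EuclideanSpace`.**  With `|u θ| ≤ U₀`, `|u′ θ| ≤ R₁`, `|u″ θ| ≤ R₂`, `|u‴ θ| ≤ R₃`, `|u⁗ θ| ≤ R₄`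
(derivatives as nested `deriv`): `‖γ′(θ)‖ ≤ √(R₁² + U₀²)`, `‖γ″(θ)‖ ≤ √((R₂+U₀)² + (2R₁)²)`, `‖γ‴(θ)‖ ≤ √((R₃+3R₁)² + (3R₂+U₀)²)`,
`‖γ⁗(θ)‖ ≤ √((R₄+6R₂+U₀)² + (4R₃+4R₁)²)` for `γ t = toLp 2 (u t • dir t)`. -/
theorem polarLp_exact_graded_jets {θ U₀ R₁ R₂ R₃ R₄ : ℝ} (h0 : |u θ| ≤ U₀) (h1 : |deriv u θ| ≤ R₁) (h2 : |deriv (deriv u) θ| ≤ R₂)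
    (h3 : |deriv (deriv (deriv u)) θ| ≤ R₃) (h4 : |deriv (deriv (deriv (deriv u))) θ| ≤ R₄) :
    ‖iteratedDeriv 1 (fun t : ℝ => (WithLp.toLp 2 (u t • dir t) : EuclideanSpace ℝ (Fin 2))) θ‖ ≤ Real.sqrt (R₁ ^ 2 + U₀ ^ 2) ∧
    ‖iteratedDeriv 2 (fun t : ℝ => (WithLp.toLp 2 (u t • dir t) : EuclideanSpace ℝ (Fin 2))) θ‖ ≤ Real.sqrt ((R₂ + U₀) ^ 2 + (2 * R₁) ^ 2) ∧
    ‖iteratedDeriv 3 (fun t : ℝ => (WithLp.toLp 2 (u t • dir t) : EuclideanSpace ℝ (Fin 2))) θ‖ ≤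
      Real.sqrt ((R₃ + 3 * R₁) ^ 2 + (3 * R₂ + U₀) ^ 2) ∧
    ‖iteratedDeriv 4 (fun t : ℝ => (WithLp.toLp 2 (u t • dir t) : EuclideanSpace ℝ (Fin 2))) θ‖ ≤
      Real.sqrt ((R₄ + 6 * R₂ + U₀) ^ 2 + (4 * R₃ + 4 * R₁) ^ 2) := by
  obtain ⟨e1, e2, e3, e4⟩ := iteratedDeriv_polarLp_eqs hu
  have U0 : 0 ≤ U₀ := (abs_nonneg _).trans h0
  have R1 : 0 ≤ R₁ := (abs_nonneg _).trans h1
  have R2 : 0 ≤ R₂ := (abs_nonneg _).trans h2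
  have R3 : 0 ≤ R₃ := (abs_nonneg _).trans h3
  refine ⟨?_, ?_, ?_, ?_⟩
  · rw [e1]; dsimp only; rw [norm_toLp_frame_comb]
    exact sqrt_sq_add_sq_le_of_abs_le h1 h0
  · rw [e2]; dsimp only; rw [norm_toLp_frame_comb]
    refine sqrt_sq_add_sq_le_of_abs_le ?_ ?_
    · exact (abs_sub _ _).trans (by linarith)
    · rw [abs_mul, abs_two]; linarith
  · rw [e3]; dsimp only; rw [norm_toLp_frame_comb]
    refine sqrt_sq_add_sq_le_of_abs_le ?_ ?_
    · refine (abs_sub _ _).trans ?_; rw [abs_mul, abs_of_pos (by norm_num : (0:ℝ) < 3)]; linarith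
    · refine (abs_sub _ _).trans ?_; rw [abs_mul, abs_of_pos (by norm_num : (0:ℝ) < 3)]; linarith
  · rw [e4]; dsimp only; rw [norm_toLp_frame_comb]
    refine sqrt_sq_add_sq_le_of_abs_le ?_ ?_
    · calc |deriv (deriv (deriv (deriv u))) θ - 6 * deriv (deriv u) θ + u θ|
          ≤ |deriv (deriv (deriv (deriv u))) θ - 6 * deriv (deriv u) θ| + |u θ| := abs_add_le _ _
        _ ≤ (|deriv (deriv (deriv (deriv u))) θ| + |6 * deriv (deriv u) θ|) + |u θ| := by gcongr; exact abs_sub _ _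
        _ ≤ R₄ + 6 * R₂ + U₀ := by rw [abs_mul, abs_of_pos (by norm_num : (0:ℝ) < 6)]; linarith
    · calc |4 * deriv (deriv (deriv u)) θ - 4 * deriv u θ| ≤ |4 * deriv (deriv (deriv u)) θ| + |4 * deriv u θ| := abs_sub _ _
        _ ≤ 4 * R₃ + 4 * R₁ := by
            rw [abs_mul, abs_mul, abs_of_pos (by norm_num : (0:ℝ) < 4)]; linarith

/-- Packaged as the `hD` hypothesis of the graded (C1) door. -/
theorem polarLp_exact_graded_jets_fun {θ U₀ R₁ R₂ R₃ R₄ : ℝ} (h0 : |u θ| ≤ U₀) (h1 : |deriv u θ| ≤ R₁) (h2 : |deriv (deriv u) θ| ≤ R₂)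
    (h3 : |deriv (deriv (deriv u)) θ| ≤ R₃) (h4 : |deriv (deriv (deriv (deriv u))) θ| ≤ R₄) :
    ∀ i, 1 ≤ i → i ≤ 4 → ‖iteratedDeriv i (fun t : ℝ => (WithLp.toLp 2 (u t • dir t) : EuclideanSpace ℝ (Fin 2))) θ‖ ≤
      (fun i : ℕ => if i = 1 then Real.sqrt (R₁ ^ 2 + U₀ ^ 2) else if i = 2 then Real.sqrt ((R₂ + U₀) ^ 2 + (2 * R₁) ^ 2)
        else if i = 3 then Real.sqrt ((R₃ + 3 * R₁) ^ 2 + (3 * R₂ + U₀) ^ 2) else Real.sqrt ((R₄ + 6 * R₂ + U₀) ^ 2 + (4 * R₃ + 4 * R₁) ^ 2)) i := by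
  obtain ⟨j1, j2, j3, j4⟩ := polarLp_exact_graded_jets hu h0 h1 h2 h3 h4
  intro i hi1 hi4
  interval_cases i
  · simpa using j1
  · simpa using j2
  · simpa using j3
  · simpa using j4

end Polar

/-! ## §4 The frame instance -/

/-- `klFermiPoint μ K = u_K • dir` with `u_K = perturbedFermiRadius (−K.eval) μ` — so §3 applies verbatim to `γ θ = toLp 2 (klFermiPoint μ K θ)`
(with `u := perturbedFermiRadius (fun p => -K.eval p) μ`, smooth by `contDiff_klFermiRadius`). -/
theorem toLp_klFermiPoint_eq (μ : ℝ) (K : TrigPolyC4v) :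
    (fun θ : ℝ => (WithLp.toLp 2 (KLRegimeSplit.klFermiPoint μ K θ) : EuclideanSpace ℝ (Fin 2))) =
      fun t => WithLp.toLp 2 (perturbedFermiRadius (fun p : Fin 2 → ℝ => -K.eval p) μ t • dir t) := rfl

end Summit.HubbardSuperconductivity.HubbardSuperconductivity.Theorems.PerturbedFermiCurve

end
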